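import Mathlib

/-!
# Tier7/Line3/DenominatorBound — bounded denominators at finitely many places = `M⁻¹ O_K` (seat t7-L1-p4)

LINE 3 (t7-plan-3), version (ii) of the isolation (memo §2e / §2f). The chain consumes ONE arithmetic fact about the
double-coset invariant twice, in two different shapes:

* the SIZE row (t7-x1, `ProductFormulaSeparation.inv_mul_pow_le_archSizeOn`, p666471) takes the finite-place bounds
  `hS : ∀ N γ, arith N γ → ∀ w ∈ S, w (κ γ − κ₀) ≤ B w` and `hout : ∀ N γ, arith N γ → ∀ w ∉ S, w ≠ v₁ → w (κ γ − κ₀) ≤ 1`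
  (plus the congruence `hcong` at `v₁`);
* the COUNT row (t7-L1-p5, `CountBoundOfKappa.count_bound_of_kappa`, p671204) takes the integrality clause
  `hdict : ∀ N γ, arith N γ → IsIntegral ℤ (M * (κ γ − κ₀)) ∧ …` with ONE `M ≠ 0` for every level `N`
  (crit-2 l. 15064 (iv): `M` must be level-independent).

THIS FILE proves, for ANY number field `K`, that the two shapes are the same statement — «`κ γ − κ₀` has bounded
denominators, uniformly in `N`»:

* `isIntegral_of_forall_le_one`: an `x ∈ K` with `w x ≤ 1` at EVERY finite place is an algebraic integer (Mathlib's
  `IsDedekindDomain.HeightOneSpectrum.mem_integers_of_valuation_le_one` read through `NumberField.FinitePlace`);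
* `exists_nat_isIntegral_of_bounds`: bounds `w x ≤ B w` at the finitely many places of `S` and `w x ≤ 1` elsewhere force
  `M x` integral for ONE natural number `M = (∏_{w ∈ S} N(𝔭_w))^k` depending only on `(S, B)` — the finite-place bounds
  give `x ∈ M⁻¹ O_K` with a uniform denominator;
* `apply_le_inv_of_isIntegral_mul` / `apply_le_one_of_isIntegral_mul` / `finite_support`: conversely `M x` integral gives
  `w x ≤ (w M)⁻¹` everywhere and `w x ≤ 1` off the finite set `{w | w M ≠ 1}`;
* the orbit forms by name: `exists_nat_isIntegral_of_hS_hout` (the hypotheses of the size row ⇒ the integrality clause of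
  the count row with a level-independent `M`) and `exists_finset_of_isIntegral` (the integrality clause ⇒ the
  `(S, v₁ ∉ S, B, hBpos, hS, hout)` package of the size row).

Nothing here is about a group, a double coset, an orbital integral or a period; the passage from the real objects to
`κ : Orb → K` is the §2a dictionary (in words, TYPING-CENSUS T7). Nothing about (N) / the step; no device. Mathlib only;
no sorry; axioms ⊆ {propext, Classical.choice, Quot.sound}.
-/

namespace Summit.Ventures.HodgeRepro2.Tier7.Line3.DenominatorBound

open NumberField IsDedekindDomain

variable {K : Type*} [Field K] [NumberField K]

section Integrality

/-- a finite place is the `v`-adic absolute value of its maximal ideal `v`. -/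
theorem apply_eq_adicAbv (w : FinitePlace K) (x : K) :
    w x = HeightOneSpectrum.adicAbv K (FinitePlace.maximalIdeal w) x := by
  rw [← FinitePlace.norm_embedding_eq w x, FinitePlace.norm_embedding]

/-- `w x ≤ 1` iff the `v`-adic valuation of `x` is `≤ 1` (`v` the maximal ideal of `w`). -/
theorem apply_le_one_iff (w : FinitePlace K) (x : K) :
    w x ≤ 1 ↔ (FinitePlace.maximalIdeal w).valuation K x ≤ 1 := by
  rw [apply_eq_adicAbv, HeightOneSpectrum.adicAbv_def, ← NNReal.coe_one, NNReal.coe_le_coe]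
  exact WithZeroMulInt.toNNReal_le_one_iff (HeightOneSpectrum.one_lt_absNorm_nnreal _)

/-- **an element with `w x ≤ 1` at every finite place is an algebraic integer** (Mathlib's
`mem_integers_of_valuation_le_one` through the finite places). -/
theorem isIntegral_of_forall_le_one (x : K) (h : ∀ w : FinitePlace K, w x ≤ 1) : IsIntegral ℤ x := by
  have hv : ∀ v : HeightOneSpectrum (𝓞 K), v.valuation K x ≤ 1 := fun v => by
    have h1 := (apply_le_one_iff (FinitePlace.mk v) x).1 (h _)
    rwa [FinitePlace.maximalIdeal_mk] at h1
  have hmem := HeightOneSpectrum.mem_integers_of_valuation_le_one K x hv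
  rw [RingHom.mem_range] at hmem
  obtain ⟨y, hy⟩ := hmem
  rw [← hy]
  exact RingOfIntegers.isIntegral_coe y

/-- an algebraic integer has `w x ≤ 1` at every finite place. -/
theorem apply_le_one_of_isIntegral (w : FinitePlace K) {x : K} (hx : IsIntegral ℤ x) : w x ≤ 1 := by
  have hx' : x = algebraMap (𝓞 K) K ⟨x, (mem_integralClosure_iff ℤ K).2 hx⟩ := rfl
  rw [hx', ← FinitePlace.norm_embedding_eq w]
  exact FinitePlace.norm_le_one K (FinitePlace.maximalIdeal w) _

/-- `w x ≤ 1` at every finite place iff `x` is an algebraic integer. -/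
theorem forall_le_one_iff_isIntegral (x : K) : (∀ w : FinitePlace K, w x ≤ 1) ↔ IsIntegral ℤ x :=
  ⟨isIntegral_of_forall_le_one x, fun hx w => apply_le_one_of_isIntegral w hx⟩

/-- a natural number has `w n ≤ 1` at every finite place. -/
theorem apply_natCast_le_one (w : FinitePlace K) (n : ℕ) : w (n : K) ≤ 1 := by
  rw [apply_eq_adicAbv]
  exact HeightOneSpectrum.adicAbv_natCast_le_one K _ n

end Integrality

section Denominator

/-- the absolute norm of the maximal ideal of a finite place, a natural number `> 1` lying in that ideal. -/
noncomputable def normAt (w : FinitePlace K) : ℕ := Ideal.absNorm (FinitePlace.maximalIdeal w).asIdeal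

/-- `1 < N(𝔭_w)`. -/
theorem one_lt_normAt (w : FinitePlace K) : 1 < normAt w :=
  HeightOneSpectrum.one_lt_absNorm (FinitePlace.maximalIdeal w)

/-- `N(𝔭_w) ≠ 0`. -/
theorem normAt_ne_zero (w : FinitePlace K) : normAt w ≠ 0 :=
  Nat.pos_iff_ne_zero.1 (zero_lt_one.trans (one_lt_normAt w))

/-- **`w (N(𝔭_w)) < 1`**: the absolute norm of `𝔭_w` lies in `𝔭_w` (`Ideal.absNorm_mem`). -/
theorem apply_normAt_lt_one (w : FinitePlace K) : w (normAt w : K) < 1 := by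
  have hmem : ((normAt w : ℕ) : 𝓞 K) ∈ (FinitePlace.maximalIdeal w).asIdeal := Ideal.absNorm_mem _
  have h := (FinitePlace.norm_lt_one_iff_mem K (FinitePlace.maximalIdeal w) ((normAt w : ℕ) : 𝓞 K)).2 hmem
  rwa [FinitePlace.norm_embedding_eq, map_natCast] at h

/-- the common denominator attached to a finite set `S` of finite places: `∏_{w ∈ S} N(𝔭_w)`. -/
noncomputable def denom (S : Finset (FinitePlace K)) : ℕ := ∏ w ∈ S, normAt w

/-- the denominator is a non-zero natural number. -/
theorem denom_ne_zero (S : Finset (FinitePlace K)) : denom S ≠ 0 :=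
  Finset.prod_ne_zero_iff.2 fun w _ => normAt_ne_zero w

/-- **`w (denom S) < 1` for every `w ∈ S`**: one factor is `< 1`, the others are `≤ 1`. -/
theorem apply_denom_lt_one {S : Finset (FinitePlace K)} {w : FinitePlace K} (hw : w ∈ S) :
    w (denom S : K) < 1 := by
  classical
  rw [denom, ← Finset.mul_prod_erase S _ hw, Nat.cast_mul, map_mul]
  calc w (normAt w : K) * w ((∏ u ∈ S.erase w, normAt u : ℕ) : K)
      ≤ w (normAt w : K) * 1 :=
        mul_le_mul_of_nonneg_left (apply_natCast_le_one w _) (apply_nonneg w _)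
    _ < 1 := by rw [mul_one]; exact apply_normAt_lt_one w

/-- for `w ∈ S` and any bound `B`, some power of the denominator beats it: `w (denom S) ^ k * B ≤ 1`. -/
theorem exists_pow_mul_le_one {S : Finset (FinitePlace K)} {w : FinitePlace K} (hw : w ∈ S) (B : ℝ) :
    ∃ k : ℕ, w (denom S : K) ^ k * B ≤ 1 := by
  by_cases hB : 0 < B
  · obtain ⟨k, hk⟩ := exists_pow_lt_of_lt_one (inv_pos.2 hB) (apply_denom_lt_one hw)
    refine ⟨k, le_of_lt ?_⟩
    calc w (denom S : K) ^ k * B < B⁻¹ * B := mul_lt_mul_of_pos_right hk hB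
      _ = 1 := inv_mul_cancel₀ hB.ne'
  · exact ⟨0, by rw [pow_zero, one_mul]; exact (not_lt.1 hB).trans zero_le_one⟩

/-- **bounded denominators at finitely many places = `M⁻¹ O_K`**: for a finite set `S` of finite places and
bounds `B`, there is ONE natural number `M ≠ 0` (depending only on `S` and `B`) such that every `x ∈ K` with
`w x ≤ B w` on `S` and `w x ≤ 1` off `S` has `M x` integral. -/
theorem exists_nat_isIntegral_of_bounds (S : Finset (FinitePlace K)) (B : FinitePlace K → ℝ) :
    ∃ M : ℕ, M ≠ 0 ∧ ∀ x : K, (∀ w ∈ S, w x ≤ B w) → (∀ w, w ∉ S → w x ≤ 1) →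
      IsIntegral ℤ ((M : K) * x) := by
  classical
  have hk : ∀ w ∈ S, ∃ k : ℕ, w (denom S : K) ^ k * B w ≤ 1 := fun w hw => exists_pow_mul_le_one hw (B w)
  choose! k hk using hk
  refine ⟨denom S ^ S.sup k, pow_ne_zero _ (denom_ne_zero S), fun x hS hout => ?_⟩
  apply isIntegral_of_forall_le_one
  intro w
  rw [Nat.cast_pow, map_mul, map_pow]
  have h0 : 0 ≤ w (denom S : K) := apply_nonneg w _
  by_cases hw : w ∈ S
  · have h1 : w (denom S : K) ^ S.sup k ≤ w (denom S : K) ^ k w :=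
      pow_le_pow_of_le_one h0 (apply_denom_lt_one hw).le (Finset.le_sup hw)
    calc w (denom S : K) ^ S.sup k * w x ≤ w (denom S : K) ^ k w * B w :=
          mul_le_mul h1 (hS w hw) (apply_nonneg w x) (pow_nonneg h0 _)
      _ ≤ 1 := hk w hw
  · calc w (denom S : K) ^ S.sup k * w x ≤ 1 * 1 :=
          mul_le_mul (pow_le_one₀ h0 (apply_natCast_le_one w _)) (hout w hw) (apply_nonneg w x) zero_le_one
      _ = 1 := mul_one 1

end Denominator

section Converse

/-- **the converse**: `M x` integral (`M ≠ 0`) gives `w x ≤ (w M)⁻¹` at every finite place. -/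
theorem apply_le_inv_of_isIntegral_mul {M x : K} (hM : M ≠ 0) (hx : IsIntegral ℤ (M * x))
    (w : FinitePlace K) : w x ≤ (w M)⁻¹ := by
  have h1 : w (M * x) ≤ 1 := apply_le_one_of_isIntegral w hx
  rw [map_mul] at h1
  have hM' : 0 < w M := FinitePlace.pos_iff.2 hM
  rw [← one_div, le_div_iff₀ hM', mul_comm]
  exact h1

/-- `M x` integral gives `w x ≤ 1` at every finite place where `w M = 1` (all but finitely many). -/
theorem apply_le_one_of_isIntegral_mul {M x : K} (hM : M ≠ 0) (hx : IsIntegral ℤ (M * x))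
    {w : FinitePlace K} (hw : w M = 1) : w x ≤ 1 := by
  have h := apply_le_inv_of_isIntegral_mul hM hx w
  rwa [hw, inv_one] at h

/-- the exceptional set `{w | w M ≠ 1}` of a non-zero `M` is finite (Mathlib's `hasFiniteMulSupport`). -/
theorem finite_support {M : K} (hM : M ≠ 0) : {w : FinitePlace K | w M ≠ 1}.Finite :=
  FinitePlace.hasFiniteMulSupport hM

end Converse

section Orbits

variable {Orb : Type*}

/-- **the size row feeds the count row**: the finite-place hypotheses `hcong` / `hS` / `hout` of
`ProductFormulaSeparation.inv_mul_pow_le_archSizeOn` give the integrality clause of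
`CountBoundOfKappa.count_bound_of_kappa`'s `hdict` with ONE natural number `M ≠ 0`, uniform in the level `N`. -/
theorem exists_nat_isIntegral_of_hS_hout (κ : Orb → K) (κ₀ : K) (arith : ℕ → Orb → Prop)
    (v₁ : FinitePlace K) (S : Finset (FinitePlace K)) {q : ℝ} (hq : 1 < q) (B : FinitePlace K → ℝ)
    (hcong : ∀ N γ, arith N γ → v₁ (κ γ - κ₀) ≤ q⁻¹ ^ N)
    (hS : ∀ N γ, arith N γ → ∀ w ∈ S, w (κ γ - κ₀) ≤ B w)
    (hout : ∀ N γ, arith N γ → ∀ w, w ∉ S → w ≠ v₁ → w (κ γ - κ₀) ≤ 1) :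
    ∃ M : ℕ, M ≠ 0 ∧ ∀ N γ, arith N γ → IsIntegral ℤ ((M : K) * (κ γ - κ₀)) := by
  obtain ⟨M, hM0, hM⟩ := exists_nat_isIntegral_of_bounds S B
  refine ⟨M, hM0, fun N γ hγ => hM _ (hS N γ hγ) fun w hw => ?_⟩
  by_cases hv : w = v₁
  · subst hv
    refine (hcong N γ hγ).trans (pow_le_one₀ (inv_nonneg.2 (zero_le_one.trans hq.le)) ?_)
    exact inv_le_one_of_one_le₀ hq.le
  · exact hout N γ hγ w hw hv

/-- **the count row feeds the size row**: the integrality clause of `hdict` (one `M ≠ 0` for every level) gives the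
`(S, v₁ ∉ S, B, hBpos, hS, hout)` package of `ProductFormulaSeparation.inv_mul_pow_le_archSizeOn`, with
`S = {w | w M ≠ 1} ∖ {v₁}` and `B w = (w M)⁻¹`. -/
theorem exists_finset_of_isIntegral (κ : Orb → K) (κ₀ : K) (arith : ℕ → Orb → Prop)
    (v₁ : FinitePlace K) {M : K} (hM : M ≠ 0)
    (hdict : ∀ N γ, arith N γ → IsIntegral ℤ (M * (κ γ - κ₀))) :
    ∃ S : Finset (FinitePlace K), v₁ ∉ S ∧ ∃ B : FinitePlace K → ℝ, (∀ w ∈ S, 0 < B w) ∧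
      (∀ N γ, arith N γ → ∀ w ∈ S, w (κ γ - κ₀) ≤ B w) ∧
      (∀ N γ, arith N γ → ∀ w, w ∉ S → w ≠ v₁ → w (κ γ - κ₀) ≤ 1) := by
  classical
  refine ⟨(finite_support hM).toFinset.erase v₁, Finset.notMem_erase v₁ _, fun w => (w M)⁻¹,
    fun w _ => inv_pos.2 (FinitePlace.pos_iff.2 hM),
    fun N γ hγ w _ => apply_le_inv_of_isIntegral_mul hM (hdict N γ hγ) w,
    fun N γ hγ w hw hv => ?_⟩
  have h1 : w M = 1 := by
    by_contra h
    exact hw (Finset.mem_erase.2 ⟨hv, (finite_support hM).mem_toFinset.2 h⟩)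
  exact apply_le_one_of_isIntegral_mul hM (hdict N γ hγ) h1

end Orbits

end Summit.Ventures.HodgeRepro2.Tier7.Line3.DenominatorBound
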